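import Mathlib
import Summits.ValiantsHypothesis.ValiantsHypothesis.Theorems.NewtonUnitEquationsTwoProductsPlanarCellChargingBound
import Summits.ValiantsHypothesis.ValiantsHypothesis.Theorems.NewtonUnitEquationsTwoProductsPlanarCellBlockMerge
import HarnessLib

/-!
# Crux `TwoProducts` (stmt-ValiantsHypothesis-5906), planar cells with ONE relation class: preliminaries
# (the superset argument with constants; fibres of the sum map under a single relation)

Helper mode (`--supports stmt-ValiantsHypothesis-5906 --as helper`; val-lit-p3 g14, KEEP lineage).  Toward rung R1
`stub_singleRelation : SingleRelationLaw` of the line `Cruxes/TwoProducts/Lines/relation_ladder.lean` (val-idea-8 g2):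
tails `u_j, v_j` supported in `A_j ∌ 0`; ONE primitive relation `(a₀, b₀)` on a position set `J` accounts for every additive
coincidence of letter tuples of `∏_j (A_j ∪ {0})` — two distinct tuples with the same point differ exactly on `J` and carry
`(a₀|J, b₀|J)` or `(b₀|J, a₀|J)` there (`hSR` below, the line's `SingleRelation` unfolded).

This file:
* `card_le_of_superset_const` — the superset / rank-one argument of `planarCell_dissociated_linear` (p603804) and
  `card_clean_class_le` (p604128) in ABSTRACT form: letter-coefficient functions `f g : Fin m → Expo → ℂ` and two CONSTANTS
  `cF, cG`, class `cF·∏ f ≠ 0, cF·∏ f ≠ cG·∏ g`, cancellation of the three upgrades `⁺ʲ, ⁺ʲ', ⁺ʲʲ'` given as a hypothesis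
  ⇒ `#C ≤ m + 1`.  (The constants absorb the block factor of a merged fibre: `F(c) + F(c*) = (F_J(a₀) + F_J(b₀))·F_off(c)`.)
* fibres under `hSR`: a tuple whose `J`-part is neither `a₀|J` nor `b₀|J` is uniquely represented (`eq_of_lone`); a tuple
  with `J`-part `a₀|J` shares its point with at most its partner `c* = (b₀ on J, c off J)` (`eq_or_eq_partner`); hence the
  coefficient of `W = ∏(1+u_j) − ∏(1+v_j)` at such a point is `cF·F_off(c) − cG·G_off(c)` with constants `cF, cG`
  INDEPENDENT of `c` (`exists_coeff_tailDiff_of_Jpart`).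
Honest framing: helper lemmas for a witness rung OUTSIDE the cone of an OPEN crux line; `PlanarCellBound`, the line's residual,
the crux `TwoProducts` and `VP ≠ VNP` are OPEN and NOT claimed.  No instances, no notation, no named facts. [folklore]
-/

noncomputable section

-- Sub = Summit single-conjunct layout: the duplicated namespace component is mandated by the tree.
set_option linter.dupNamespace false

open scoped BigOperators
open MvPolynomial
open Summit.ValiantsHypothesis.ValiantsHypothesis.Theorems.NewtonUnitEquations.TwoProducts.FormalLogLinearisation

namespace Summit.ValiantsHypothesis.ValiantsHypothesis.Theorems.NewtonUnitEquations.TwoProducts.PlanarCell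

variable {m : ℕ}

/-! ## The superset argument with constants -/

/-- **SUPERSET ARGUMENT, ABSTRACT FORM WITH CONSTANTS.**  Letter coefficients `f g : Fin m → Expo → ℂ`, constants `cF cG`,
a weight `ζ`, representations `rep`.  If the points of `C` are pairwise letterwise non-dominated, lie in the class
`cF·∏ f(rep l) ≠ 0 ∧ cF·∏ f(rep l) ≠ cG·∏ g(rep l)`, and for all `l l₁ l₂ ∈ C` and positions `j ≠ j'` at which `l₁, l₂`
carry STRICTLY heavier letters the three upgraded tuples satisfy `cF·∏ f = cG·∏ g`, then `#C ≤ m + 1`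
(each point has at most one improvable position, and `point ↦ improvable position` is injective). [folklore] -/
theorem card_le_of_superset_const (cF cG : ℂ) (f g : Fin m → Expo → ℂ) (ζ : Fin 2 → ℝ)
    (rep : Expo → Fin m → Expo) (C : Finset Expo)
    (hnodom : ∀ l ∈ C, ∀ l' ∈ C, l ≠ l' → ∃ j, wt ζ (rep l j) < wt ζ (rep l' j))
    (hCF : ∀ l ∈ C, cF * ∏ j, f j (rep l j) ≠ 0 ∧ cF * ∏ j, f j (rep l j) ≠ cG * ∏ j, g j (rep l j))
    (hcancel : ∀ l ∈ C, ∀ l₁ ∈ C, ∀ l₂ ∈ C, ∀ j j' : Fin m, j ≠ j' →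
      wt ζ (rep l j) < wt ζ (rep l₁ j) → wt ζ (rep l j') < wt ζ (rep l₂ j') →
      ∀ a' : Fin m → Expo, (a' = Function.update (rep l) j (rep l₁ j) ∨ a' = Function.update (rep l) j' (rep l₂ j') ∨
          a' = Function.update (Function.update (rep l) j (rep l₁ j)) j' (rep l₂ j')) →
        cF * ∏ i, f i (a' i) = cG * ∏ i, g i (a' i)) :
    C.card ≤ m + 1 := by
  classical
  -- improvable positions: at most one per point of `C`
  have himp : ∀ l ∈ C, ∀ j j' : Fin m, ∀ l₁ ∈ C, ∀ l₂ ∈ C,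
      wt ζ (rep l j) < wt ζ (rep l₁ j) → wt ζ (rep l j') < wt ζ (rep l₂ j') → j = j' := by
    intro l hl j j' l₁ hl₁ l₂ hl₂ hj hj'
    by_contra hjj
    set a := rep l with ha
    set p := rep l₁ j with hp
    set p' := rep l₂ j' with hp'
    have hc := hcancel l hl l₁ hl₁ l₂ hl₂ j j' hjj hj hj'
    have c1 := hc _ (Or.inl rfl)
    have c2 := hc _ (Or.inr (Or.inl rfl))
    have c12 := hc _ (Or.inr (Or.inr rfl))
    -- rank-one identities
    have idF := prod_mul_prod_update_update f a hjj p p'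
    have idG := prod_mul_prod_update_update g a hjj p p'
    -- nonvanishing of `cF · F(a⁺ʲʲ')`
    have hcF : cF ≠ 0 := fun h => (hCF l hl).1 (by rw [h, zero_mul])
    have hF12 : ∏ i, f i (Function.update (Function.update a j p) j' p' i) ≠ 0 := by
      rw [Finset.prod_ne_zero_iff]
      intro i _
      by_cases hi : i = j'
      · subst hi; rw [Function.update_self]
        have h2 := (hCF l₂ hl₂).1
        rw [mul_ne_zero_iff, Finset.prod_ne_zero_iff] at h2
        exact h2.2 i (Finset.mem_univ _)
      · rw [Function.update_of_ne hi]
        by_cases hi2 : i = j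
        · subst hi2; rw [Function.update_self]
          have h1 := (hCF l₁ hl₁).1
          rw [mul_ne_zero_iff, Finset.prod_ne_zero_iff] at h1
          exact h1.2 i (Finset.mem_univ _)
        · rw [Function.update_of_ne hi2]
          have h0 := (hCF l hl).1
          rw [mul_ne_zero_iff, Finset.prod_ne_zero_iff] at h0
          exact h0.2 i (Finset.mem_univ _)
    apply (hCF l hl).2
    have key : (cF * ∏ i, f i (a i) - cG * ∏ i, g i (a i)) *
        (cF * ∏ i, f i (Function.update (Function.update a j p) j' p' i)) = 0 := by
      linear_combination (cF ^ 2) * idF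
        + (cF * ∏ i, f i (Function.update a j' p' i)) * c1
        + (cG * ∏ i, g i (Function.update a j p i)) * c2
        - (cG * ∏ i, g i (a i)) * c12 - (cG ^ 2) * idG
    rcases mul_eq_zero.1 key with h | h
    · exact sub_eq_zero.1 h
    · exact absurd h (mul_ne_zero hcF hF12)
  -- the injection into `Option (Fin m)`
  let Φ : Expo → Option (Fin m) := fun l =>
    if h : ∃ j : Fin m, ∃ l' ∈ C, wt ζ (rep l j) < wt ζ (rep l' j) then some (Classical.choose h) else none
  have hΦspec : ∀ l ∈ C, ∀ j, Φ l = some j → ∃ l' ∈ C, wt ζ (rep l j) < wt ζ (rep l' j) := by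
    intro l _ j hj
    simp only [Φ] at hj
    split_ifs at hj with h
    · have := Classical.choose_spec h
      rw [Option.some.injEq] at hj
      rwa [← hj]
  have hΦnone : ∀ l ∈ C, Φ l = none → ∀ j, ∀ l' ∈ C, ¬ wt ζ (rep l j) < wt ζ (rep l' j) := by
    intro l _ hnone j l' hl' hlt
    simp only [Φ] at hnone
    split_ifs at hnone with h
    exact h ⟨j, l', hl', hlt⟩
  have hinj : Set.InjOn Φ ↑C := by
    intro l hl l' hl' heq
    by_contra hne
    obtain ⟨j, hj⟩ := hnodom l hl l' hl' hne
    obtain ⟨j', hj'⟩ := hnodom l' hl' l hl (Ne.symm hne)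
    rcases hΦ : Φ l with _ | i
    · exact hΦnone l hl hΦ j l' hl' hj
    · obtain ⟨l₁, hl₁, hlt₁⟩ := hΦspec l hl i hΦ
      have hi : i = j := himp l hl i j l₁ hl₁ l' hl' hlt₁ hj
      rw [hΦ] at heq
      obtain ⟨l₂, hl₂, hlt₂⟩ := hΦspec l' hl' i heq.symm
      have hi' : i = j' := himp l' hl' i j' l₂ hl₂ l hl hlt₂ hj'
      rw [← hi] at hj; rw [← hi'] at hj'
      exact absurd (hj.trans hj') (lt_irrefl _)
  calc C.card ≤ (Finset.univ : Finset (Option (Fin m))).card :=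
        Finset.card_le_card_of_injOn Φ (fun _ _ => Finset.mem_univ _) hinj
    _ = m + 1 := by simp

/-! ## Splitting a letter product at the block `J` -/

/-- `∏_i h_i(c_i) = (∏_{i∈J} h_i(c_i)) · ∏_i [i ∉ J] h_i(c_i)` (the off-block part kept as a product over all positions with
`1` on the block, the shape used by `card_le_of_superset_const`). [folklore] -/
theorem prod_eq_prod_block_mul_prod_off (h : Fin m → Expo → ℂ) (c : Fin m → Expo) (J : Finset (Fin m)) :
    ∏ i, h i (c i) = (∏ i ∈ J, h i (c i)) * ∏ i, (if i ∈ J then 1 else h i (c i)) := by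
  classical
  have h1 : ∏ i, h i (c i) = ∏ i, ((if i ∈ J then h i (c i) else 1) * (if i ∈ J then 1 else h i (c i))) :=
    Finset.prod_congr rfl fun i _ => by by_cases hi : i ∈ J <;> simp [hi]
  rw [h1, Finset.prod_mul_distrib, Finset.prod_ite_mem, Finset.univ_inter]

/-- The off-block product only sees the letters off `J`. [folklore] -/
theorem prod_off_congr (h : Fin m → Expo → ℂ) {c c' : Fin m → Expo} (J : Finset (Fin m))
    (hcc : ∀ i, i ∉ J → c i = c' i) :
    ∏ i, (if i ∈ J then 1 else h i (c i)) = ∏ i, (if i ∈ J then 1 else h i (c' i)) :=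
  Finset.prod_congr rfl fun i _ => by
    by_cases hi : i ∈ J
    · simp [hi]
    · simp [hi, hcc i hi]

/-! ## Fibres of the sum map under a single relation -/

/-- **Lone tuples are uniquely represented.**  Under the single relation `(J, a₀, b₀)`, a letter tuple whose `J`-part is
neither `a₀|J` nor `b₀|J` is the only tuple of `∏_j (A_j ∪ {0})` with its point. [folklore] -/
theorem eq_of_lone (A : Fin m → Finset Expo) (J : Finset (Fin m)) (a₀ b₀ : Fin m → Expo)
    (hSR : ∀ a ∈ tuples A, ∀ b ∈ tuples A, a ≠ b → ∑ j, a j = ∑ j, b j →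
      (∀ j, a j ≠ b j ↔ j ∈ J) ∧ ((∀ j ∈ J, a j = a₀ j ∧ b j = b₀ j) ∨ (∀ j ∈ J, a j = b₀ j ∧ b j = a₀ j)))
    {c : Fin m → Expo} (hc : c ∈ tuples A) (hca : ¬ ∀ i ∈ J, c i = a₀ i) (hcb : ¬ ∀ i ∈ J, c i = b₀ i)
    {b : Fin m → Expo} (hb : b ∈ tuples A) (hsum : ∑ j, b j = ∑ j, c j) : b = c := by
  by_contra hne
  obtain ⟨-, hcase⟩ := hSR c hc b hb (Ne.symm hne) hsum.symm
  rcases hcase with h | h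
  · exact hca fun i hi => (h i hi).1
  · exact hcb fun i hi => (h i hi).1

/-- **Merged tuples have at most their partner.**  Under the single relation, a tuple `c` with `J`-part `a₀|J` shares its
point only with `c* = (b₀ on J, c off J)`. [folklore] -/
theorem eq_or_eq_partner (A : Fin m → Finset Expo) (J : Finset (Fin m)) (a₀ b₀ : Fin m → Expo)
    (hSR : ∀ a ∈ tuples A, ∀ b ∈ tuples A, a ≠ b → ∑ j, a j = ∑ j, b j →
      (∀ j, a j ≠ b j ↔ j ∈ J) ∧ ((∀ j ∈ J, a j = a₀ j ∧ b j = b₀ j) ∨ (∀ j ∈ J, a j = b₀ j ∧ b j = a₀ j)))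
    {c : Fin m → Expo} (hc : c ∈ tuples A) (hcJ : ∀ i ∈ J, c i = a₀ i)
    {b : Fin m → Expo} (hb : b ∈ tuples A) (hsum : ∑ j, b j = ∑ j, c j) :
    b = c ∨ b = fun i => if i ∈ J then b₀ i else c i := by
  classical
  by_cases hbc : b = c
  · exact Or.inl hbc
  right
  obtain ⟨hiff, hcase⟩ := hSR c hc b hb (Ne.symm hbc) hsum.symm
  funext i
  by_cases hi : i ∈ J
  · rw [if_pos hi]
    rcases hcase with h | h
    · exact (h i hi).2
    · exfalso
      exact ((hiff i).2 hi) (by rw [hcJ i hi, (h i hi).2])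
  · rw [if_neg hi]
    by_contra hne
    exact hi ((hiff i).1 (Ne.symm hne))

/-- Sum of a tuple split at the block `J`. [folklore] -/
theorem sum_eq_sum_block_add_sum_off (c : Fin m → Expo) (J : Finset (Fin m)) :
    ∑ i, c i = ∑ i ∈ J, c i + ∑ i ∈ Finset.univ.filter (fun i => i ∉ J), c i := by
  classical
  rw [← Finset.sum_filter_add_sum_filter_not Finset.univ (fun i => i ∈ J), Finset.filter_univ_mem]

/-- **COEFFICIENTS ON A MERGED FAMILY.**  Under the single relation `(J, a₀, b₀)` there are CONSTANTS `cF, cG` such that for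
every letter tuple `c` with `J`-part `a₀|J` the coefficient of `W = ∏(1+u_j) − ∏(1+v_j)` at `Σ c` is
`cF · ∏_{i∉J} û_i(c_i) − cG · ∏_{i∉J} v̂_i(c_i)` — the fibre `{c, c*}` sums to `(F_J(a₀) + [c* present]·F_J(b₀))·F_off(c)`,
and the presence of the partner does not depend on `c`. [folklore] -/
theorem exists_coeff_tailDiff_of_Jpart (u v : Fin m → MvPolynomial (Fin 2) ℂ) (A : Fin m → Finset Expo)
    (hA0 : ∀ j, (0 : Expo) ∉ A j) (huA : ∀ j, (u j).support ⊆ A j) (hvA : ∀ j, (v j).support ⊆ A j)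
    (J : Finset (Fin m)) (a₀ b₀ : Fin m → Expo)
    (hSR : ∀ a ∈ tuples A, ∀ b ∈ tuples A, a ≠ b → ∑ j, a j = ∑ j, b j →
      (∀ j, a j ≠ b j ↔ j ∈ J) ∧ ((∀ j ∈ J, a j = a₀ j ∧ b j = b₀ j) ∨ (∀ j ∈ J, a j = b₀ j ∧ b j = a₀ j))) :
    ∃ cF cG : ℂ, ∀ c ∈ tuples A, (∀ i ∈ J, c i = a₀ i) →
      coeff (∑ i, c i) (tailDiff u v) =
        cF * ∏ i, (if i ∈ J then 1 else hatCoeff (u i) (c i)) - cG * ∏ i, (if i ∈ J then 1 else hatCoeff (v i) (c i)) := by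
  classical
  set PF := tuples A with hPF
  have hPF' : PF = Fintype.piFinset (fun j => insert (0 : Expo) (A j)) := rfl
  -- the partner tuple
  let star : (Fin m → Expo) → (Fin m → Expo) := fun c i => if i ∈ J then b₀ i else c i
  have hstar_on : ∀ c, ∀ i ∈ J, star c i = b₀ i := fun c i hi => by simp [star, hi]
  have hstar_off : ∀ c, ∀ i, i ∉ J → star c i = c i := fun c i hi => by simp [star, hi]
  -- the `c`-free presence condition
  let cond : Prop := (∀ i ∈ J, b₀ i ∈ insert (0 : Expo) (A i)) ∧ (∑ i ∈ J, b₀ i = ∑ i ∈ J, a₀ i) ∧ (∃ i ∈ J, b₀ i ≠ a₀ i)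
  -- presence of the partner ↔ cond, for `c ∈ PF` with `J`-part `a₀|J`
  have hsum_star : ∀ c : Fin m → Expo, (∀ i ∈ J, c i = a₀ i) →
      (∑ i, star c i = ∑ i, c i ↔ ∑ i ∈ J, b₀ i = ∑ i ∈ J, a₀ i) := by
    intro c hcJ
    rw [sum_eq_sum_block_add_sum_off (star c) J, sum_eq_sum_block_add_sum_off c J]
    have e1 : ∑ i ∈ J, star c i = ∑ i ∈ J, b₀ i := Finset.sum_congr rfl fun i hi => hstar_on c i hi
    have e2 : ∑ i ∈ J, c i = ∑ i ∈ J, a₀ i := Finset.sum_congr rfl fun i hi => hcJ i hi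
    have e3 : ∑ i ∈ Finset.univ.filter (fun i => i ∉ J), star c i = ∑ i ∈ Finset.univ.filter (fun i => i ∉ J), c i :=
      Finset.sum_congr rfl fun i hi => hstar_off c i (Finset.mem_filter.1 hi).2
    rw [e1, e2, e3]
    exact ⟨fun h => add_right_cancel h, fun h => by rw [h]⟩
  have hmem_star : ∀ c ∈ PF, (star c ∈ PF ↔ ∀ i ∈ J, b₀ i ∈ insert (0 : Expo) (A i)) := by
    intro c hc
    rw [hPF', Fintype.mem_piFinset] at hc ⊢
    constructor
    · intro h i hi; have := h i; rwa [hstar_on c i hi] at this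
    · intro h i
      by_cases hi : i ∈ J
      · rw [hstar_on c i hi]; exact h i hi
      · rw [hstar_off c i hi]; exact hc i
  have hne_star : ∀ c : Fin m → Expo, (∀ i ∈ J, c i = a₀ i) → (star c ≠ c ↔ ∃ i ∈ J, b₀ i ≠ a₀ i) := by
    intro c hcJ
    constructor
    · intro h
      by_contra hall
      push Not at hall
      apply h
      funext i
      by_cases hi : i ∈ J
      · rw [hstar_on c i hi, hall i hi, hcJ i hi]
      · rw [hstar_off c i hi]
    · rintro ⟨i, hi, hne⟩ h
      apply hne
      have := congrFun h i
      rw [hstar_on c i hi, hcJ i hi] at this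
      exact this
  -- fibre sums
  have hfibre : ∀ (w : Fin m → MvPolynomial (Fin 2) ℂ), (∀ j, (w j).support ⊆ A j) → ∀ c ∈ PF, (∀ i ∈ J, c i = a₀ i) →
      coeff (∑ i, c i) (∏ j, (1 + w j)) =
        ∏ j, hatCoeff (w j) (c j) + (if cond then ∏ j, hatCoeff (w j) (star c j) else 0) := by
    intro w hw c hc hcJ
    rw [coeff_prod_one_add_eq_fibreSum w A hA0 hw, ← hPF']
    set Fib := PF.filter (fun b => ∑ j, b j = ∑ j, c j) with hFib
    have hcFib : c ∈ Fib := Finset.mem_filter.2 ⟨hc, rfl⟩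
    rw [← Finset.add_sum_erase _ _ hcFib]
    congr 1
    by_cases hcond : cond
    · rw [if_pos hcond]
      have hstarPF : star c ∈ PF := (hmem_star c hc).2 hcond.1
      have hstarsum : ∑ i, star c i = ∑ i, c i := (hsum_star c hcJ).2 hcond.2.1
      have hstarne : star c ≠ c := (hne_star c hcJ).2 hcond.2.2
      have hErase : Fib.erase c = {star c} := by
        ext b
        rw [Finset.mem_erase, hFib, Finset.mem_filter, Finset.mem_singleton]
        constructor
        · rintro ⟨hbc, hb, hbsum⟩
          rcases eq_or_eq_partner A J a₀ b₀ hSR hc hcJ hb hbsum with h | h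
          · exact absurd h hbc
          · exact h
        · rintro rfl; exact ⟨hstarne, hstarPF, hstarsum⟩
      rw [hErase, Finset.sum_singleton]
    · rw [if_neg hcond]
      have hErase : Fib.erase c = ∅ := by
        rw [Finset.eq_empty_iff_forall_notMem]
        intro b hb
        rw [Finset.mem_erase, hFib, Finset.mem_filter] at hb
        obtain ⟨hbc, hbPF, hbsum⟩ := hb
        rcases eq_or_eq_partner A J a₀ b₀ hSR hc hcJ hbPF hbsum with h | h
        · exact hbc h
        · apply hcond
          subst h
          exact ⟨(hmem_star c hc).1 hbPF, (hsum_star c hcJ).1 hbsum, (hne_star c hcJ).1 hbc⟩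
      rw [hErase, Finset.sum_empty]
  -- the constants
  refine ⟨(∏ i ∈ J, hatCoeff (u i) (a₀ i)) + (if cond then ∏ i ∈ J, hatCoeff (u i) (b₀ i) else 0),
    (∏ i ∈ J, hatCoeff (v i) (a₀ i)) + (if cond then ∏ i ∈ J, hatCoeff (v i) (b₀ i) else 0), ?_⟩
  intro c hc hcJ
  have hW : tailDiff u v = ∏ j, (1 + u j) - ∏ j, (1 + v j) := rfl
  rw [hW, coeff_sub, hfibre u huA c hc hcJ, hfibre v hvA c hc hcJ]
  -- split every product at the block
  have blockA : ∀ (w : Fin m → MvPolynomial (Fin 2) ℂ), ∏ i ∈ J, hatCoeff (w i) (c i) = ∏ i ∈ J, hatCoeff (w i) (a₀ i) :=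
    fun w => Finset.prod_congr rfl fun i hi => by rw [hcJ i hi]
  have blockB : ∀ (w : Fin m → MvPolynomial (Fin 2) ℂ),
      ∏ i ∈ J, hatCoeff (w i) (star c i) = ∏ i ∈ J, hatCoeff (w i) (b₀ i) :=
    fun w => Finset.prod_congr rfl fun i hi => by rw [hstar_on c i hi]
  have offB : ∀ (w : Fin m → MvPolynomial (Fin 2) ℂ),
      ∏ i, (if i ∈ J then 1 else hatCoeff (w i) (star c i)) = ∏ i, (if i ∈ J then 1 else hatCoeff (w i) (c i)) :=
    fun w => prod_off_congr (fun i e => hatCoeff (w i) e) J fun i hi => hstar_off c i hi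
  rw [prod_eq_prod_block_mul_prod_off (fun i e => hatCoeff (u i) e) c J,
    prod_eq_prod_block_mul_prod_off (fun i e => hatCoeff (v i) e) c J,
    prod_eq_prod_block_mul_prod_off (fun i e => hatCoeff (u i) e) (star c) J,
    prod_eq_prod_block_mul_prod_off (fun i e => hatCoeff (v i) e) (star c) J]
  simp only [blockA, blockB, offB]
  by_cases hcond : cond
  · simp only [if_pos hcond]; ring
  · simp only [if_neg hcond]; ring

end Summit.ValiantsHypothesis.ValiantsHypothesis.Theorems.NewtonUnitEquations.TwoProducts.PlanarCell

end
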